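import Mathlib
import HarnessLib
import Summits.ValiantsHypothesis.ValiantsHypothesis.Theses.MonotoneRestoration
import Literature.Computability.AlgebraicComplexity.ArithCircuit
import Literature.Computability.AlgebraicComplexity.ArithCircuitProofs
import Literature.Computability.AlgebraicComplexity.MonotoneStructure
import Literature.Computability.AlgebraicComplexity.PermanentIrreducible
import Literature.ModelTheory.FiniteModelTheory.CkEquiv
import Summits.ValiantsHypothesis.ValiantsHypothesis.Theorems.MonotoneRestorationMonotoneRestorationQPCosetCount
import Summits.ValiantsHypothesis.ValiantsHypothesis.Theorems.MonotoneRestorationMonotoneRestorationQPSymmetricLB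
import Summits.ValiantsHypothesis.ValiantsHypothesis.Theorems.MonotoneRestorationMonotoneRestorationQPSupportSymmetrisation
import Summits.ValiantsHypothesis.ValiantsHypothesis.Theorems.MonotoneRestorationMonotoneRestorationQPSparseRegime
import Summits.ValiantsHypothesis.ValiantsHypothesis.Theorems.MonotoneRestorationMonotoneRestorationQPBeta
import Literature.Computability.AlgebraicComplexity.SymmetricArithCircuit
import Literature.Computability.AlgebraicComplexity.DawarWilsenach2025Proofs
import Literature.GroupTheory.PermutationGroups.SmallIndexSubgroups
import Summits.ValiantsHypothesis.ValiantsHypothesis.Theorems.MonotoneRestorationQP.Negative.LoadBearing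
import Summits.ValiantsHypothesis.ValiantsHypothesis.Theorems.MonotoneRestorationMonotoneRestorationQPPermSupportCount
import Literature.Computability.AlgebraicComplexity.ElementarySymmetricCircuit

/-! TTRL-lite variant V19259 of stmt-ValiantsHypothesis-15886

Target `stub_esymmRowSums_complexity`, move `lemma_proposal` (`[esymm_plain]`): the core dynamic
programme on the clean object — over the semiring `ℝ≥0` (monotone, fan-in-two measure
`complexity`), `L(e_d(y_1, …, y_n)) ≤ 2 (d + 1) n`. This is exactly the tree's
`Literature.Computability.AlgebraicComplexity.complexity_esymm_fin_le` (the `(d+1) × n` DP table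
folded into one state polynomial `Σ_j Z_j e_{d-j}` and realised as `n` substitutions
`Z_j ↦ Z_j + y_i Z_{j-1}`, Bürgisser 2000, Rem. 2.7), specialised to `R := ℝ≥0`. -/

-- `Summit.ValiantsHypothesis.ValiantsHypothesis.…` is the tree's mandated single-conjunct layout
-- (Sub = Summit), so the duplicated namespace component is intended.
set_option linter.dupNamespace false

namespace Summit.ValiantsHypothesis.ValiantsHypothesis.Theorems

open Summit.ValiantsHypothesis.ValiantsHypothesis.Theses.MonotoneRestoration
open Literature.Computability.AlgebraicComplexity

/-- TTRL-lite variant V19259 (`[esymm_plain]`) of `stub_esymmRowSums_complexity`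
(stmt-ValiantsHypothesis-15886): over `ℝ≥0` the elementary symmetric polynomial
`e_d(y_1, …, y_n)` has fan-in-two (monotone) circuit complexity at most `2 (d + 1) n` — the
dynamic programme `e_r(y_1..y_i) = e_r(y_1..y_{i-1}) + y_i · e_{r-1}(y_1..y_{i-1})`, one product
and one sum gate per table entry; immediate from the tree's `complexity_esymm_fin_le`.
[cite: Burgisser2000, Def. 2.1 / Rem. 2.7] -/
theorem stub_esymmRowSums_complexity_var19259 :
    ∀ n d : ℕ, complexity (MvPolynomial.esymm (Fin n) NNReal d) ≤ 2 * (d + 1) * n :=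
  fun n d => complexity_esymm_fin_le d n

end Summit.ValiantsHypothesis.ValiantsHypothesis.Theorems
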